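import Summits.CriticalPhenomena.PercolationContinuityZ3.Theorems.PercNearOneGluingNoHeavyQuantWindowMixSliceRule
import Summits.CriticalPhenomena.PercolationContinuityZ3.Theorems.PercNearOneGluingNoHeavyQuantGatedSliceMixLawPrime
import HarnessLib

/-!
# QUANT lane R8, T-DEC, leg (III): THE TWO TYPINGS OF THE WINDOW FORM CW AGREE (`GatedSliceWindowDEC ↔ WindowMixDEC`), AND AN
# INDEPENDENT KERNEL REDUCTION OF CW TO TYPER g29'S LAW-LEVEL LEMMA — **`GatedSliceMixLaw' → WindowMixDEC`** (hence PM in full), via the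
# slice theorem's single-layer domination WITH ITS RULE (`sliceSingleLayer_rule`, part 1) and the certificate dichotomy of LEAD-NOTES-G31 N117

builds on p205010 (kernel theorem, internal audit signed; external expert review pending)

Support file (`--supports stmt-CriticalPhenomena-4575`), QUANT lane lead seat prim-quant-lead (gen 31), rung R8 of
`run/shared/lean/prim/quant/LADDER.md`.  Part 2 of 2 (part 1 `…QuantWindowMixSliceRule`, p343301: `sliceSingleLayer_rule`, `priceValid_mono_target`,
`windowMix_prices_of_layer`, `windowMix_eq_sum_extreme`).  Theorems only, standard axioms, no sorries, NO new conjecture: the law-level hypothesis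
is typer g29's `@[conjecture] LawDec.GatedSliceMixLaw'` (`…QuantGatedSliceMixLawPrime`, p343111), whose statement the lead reached independently
in the same hour as "Z°" (LEAD-NOTES-G31 N119: ∃ θ ∈ [0,1] with θ·Q + (1−θ)·L_h DEC; under TA the zero-mid pair is heavy, `pairGate y S 0 h = S/h`,
so `L_h = weakMidLaw S g h a`, and the closed θ-range is exactly the primed form: when `W_h` is DEC the mixture statement is vacuous/trivial).

(1) **`gatedSliceWindowDEC_iff_windowMixDEC`** — typer g29's `GatedSliceWindowDEC` (p342110; law `slice ν a g + g z(δ₀ − δ_a)`, target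
`S + ag − zag`) and the lead's `WindowMixDEC` (p342481; law `(1−g)ν + g·shiftBut ν a z`, target `S + ag(1−z)`) are ONE statement
(`windowMix_eq_slice_add`); everything landed against either binder (arm-1 g40's `windowMix_of_critE`, typer's `sdecUpTo_slice_blob_of_window`,
the lead's `sdecUpTo_slice_of_windowMix` / `windowMixDEC_of_singleLayer`) transfers.
(2) **`windowMixDEC_of_mixLaw' : GatedSliceMixLaw' → WindowMixDEC`** — a second, independent proof of the reduction (typer g29's is
`gatedSliceWindowDEC_of_mixLaw'`), in the lead's vocabulary.  THE ARGUMENT (N117–N119).  Fix the CW data and a price system `e = coefAt t j α β` of the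
mixture at `t = S + ag(1−z)`; pull back: `Σ_p e(p)P(p) = Σ_k Ψ(k)ν k + z·D`, `Ψ = slicePullback t g j a α β`, `D = g(e 0 − e a)`.  (i) `j < a`:
`mixedShift_of_lt`.  (ii) `sliceSingleLayer_rule` at target `t − ag` gives the cheapest giant `q₀`, the rule layer `J` and `Ψ` a price system at
`(t − ag, J)`, hence at `(S, J)` (`priceValid_mono_target`).  If `D ≤ 0`, `Ψ + zD` is a price system at `(S,J)`: weak duality
(`windowMix_prices_of_layer`, `m = ζ = 0`).  (iii) `D > 0` and every zero-MID pair `(0,h)` of `(S,J)` satisfies `(1−γ)e(0) + γΨ(h) ≤ 0`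
(`γ = pairGate y S 0 h`): the ZERO-REPRICED pullback `Ψ + D·[k=0]` (`m = 0`, `ζ = D`) is a price system at `(S,J)` — zero-giant pairs by the rule
(`β q₀ ≤ −Ψ(h)` above `J`, `e 0 ≤ (y/(1−y))β q₀`) — weak duality plus `ζ(ν 0 − z) ≥ 0`.  (iv) Otherwise a zero-mid pair is violated:
`(1−γ)e 0 + γΨ(h) > 0`, i.e. `e` prices the weak-mid law `W_h = weakMidLaw S g h a` positively (`γ = S/h` under TA), so `W_h` is NOT DEC
(weak duality); decompose `ν̂ = (ν − zδ₀)/(1−z)` by Lemma P (`exists_twoPoint_decomposition`) into two-point laws `τ_r` of mean `S/(1−z)`,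
`P = Σ_r λ_r Q_r`, `Q_r = zδ₀ + (1−z)·slice τ_r a g` (`windowMix_eq_sum_extreme`); `GatedSliceMixLaw'` gives `θ < 1` with `θW_h + (1−θ)Q_r` DEC,
so `θ·(e·W_h) + (1−θ)(e·Q_r) ≤ 0` forces `e·Q_r ≤ 0` for every `r`; hence `e·P ≤ 0`.  Strong duality (`decAtT_iff_prices`) gives CW.
(3) **`sdecUpTo_slice_of_mixLaw'`, `sdec_slice_of_mixLaw'`** — PM in full ⟸ `GatedSliceMixLaw'`, in the lead's binder.

EVIDENCE (exact; LEAD-NOTES-G31 N111–N119): CW vertex census kit j173052 **8 799 514 support × parameter points / 30 849 422 vertices / 0**;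
455 229 / 455 229 non-trivial extreme rays single-layer dominated at the rule layer; dichotomy 5 112/5 112 + 85 889/85 889 + 76 459 ray sums; the
law-level statement (Z° form ≡ `GatedSliceMixLaw'`): 707 409 exact LP cases / 0 (M ≤ 11, a ≤ 4; kit j174872 at M ≤ 16); typer g29: ≈ 630 k / 0.
HONEST STATUS: `GatedSliceMixLaw'`, `WindowMixDEC` (= `GatedSliceWindowDEC`), `WindowMixSingleLayer`, `GateMove`, `GatedConvEmptyFree`,
`SingleGateConvClosed`, `SDECConvClosed`, `TreeDEC`, `FarTreeRow` are OPEN; the RATE class log\* and the honest sentence of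
`run/shared/lean/prim/quant/README.md` are unchanged.

[this work]; `GatedSliceWindowDEC`, `weakMidLaw`, `GatedSliceMixLaw'`, `sum_coef_weakMidLaw`: prim-quant-stmt g29; single-layer domination and its rule:
prim-quant-census-2 g55 / prim-quant-stmt g24; Lemma P: this lane (census-2 g50 / typer g18).  The gluing rows served [cite: KozmaNitzan2024, Conjecture 3
(p. 15)]; product measure [cite: Grimmett1999, §1.3 p. 10]; Farkas [cite: Schrijver1986, Cor 7.1f (p. 90)].
-/


noncomputable section

namespace Summit.CriticalPhenomena.PercolationContinuityZ3.Theorems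

namespace Quant

open Finset

/-- the two-point law `{lo, hi; g}` (as in `…QuantLawDEC`) -/
local notation3 "TP[" lo ", " hi ", " g ", " h "]" =>
  (g : ℝ) * (if (h : ℕ) = (hi : ℕ) then (1 : ℝ) else 0) + (1 - (g : ℝ)) * (if (h : ℕ) = (lo : ℕ) then (1 : ℝ) else 0)

namespace LawDec

/-! ### (2) The two typings of CW agree -/

/-- **`GatedSliceWindowDEC ↔ WindowMixDEC`**: typer g29's typing (p342110; conclusion law `slice ν a g + g z (δ₀ − δ_a)`, target `S + ag − zag`,
window `∀ i, i ≤ j → j ≤ i + a`) and the lead's (p342481; law `(1−g)ν + g·shiftBut ν a z`, target `S + ag(1−z)`) are the same statement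
(`windowMix_eq_slice_add`). [this work] -/
theorem gatedSliceWindowDEC_iff_windowMixDEC : GatedSliceWindowDEC ↔ WindowMixDEC := by
  have hlaw : ∀ (ν : ℕ → ℝ) (a : ℕ) (g z : ℝ),
      (fun h => (1 - g) * ν h + g * shiftBut ν a z h)
        = (fun h => slice ν a g h + g * z * ((if h = 0 then (1 : ℝ) else 0) - (if h = a then (1 : ℝ) else 0))) := by
    intro ν a g z; funext h; exact windowMix_eq_slice_add ν a g z h
  have htgt : ∀ (S g z : ℝ) (a : ℕ), S + (a : ℝ) * g * (1 - z) = S + (a : ℝ) * g - z * (a : ℝ) * g := by intro S g z a; ring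
  constructor
  · intro hG y z g S a j M ν hy0 hy1 hz0 hzν hg1 hyg ha hν0 hνM hν1 hS hta hjM hwin
    rw [hlaw, htgt]
    exact hG y z g S a j M ν hy0 hy1 hz0 hzν hg1 hyg ha hν0 hνM hν1 hS hta hjM (fun i h1 h2 => hwin i h2 h1)
  · intro hW y z g S a j M ν hy0 hy1 hz0 hzν hg1 hyg ha hν0 hνM hν1 hS hta hjM hwin
    rw [← hlaw, ← htgt]
    exact hW y z g S a j M ν hy0 hy1 hz0 hzν hg1 hyg ha hν0 hνM hν1 hS hta hjM (fun i h1 h2 => hwin i h2 h1)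

/-! ### (3) CW from typer g29's law-level lemma `GatedSliceMixLaw'` — an independent reduction in the lead's binder -/

/-- **`GatedSliceMixLaw' → WindowMixDEC`** (the argument of the module docstring; independent of typer g29's `gatedSliceWindowDEC_of_mixLaw'`). [this work] -/
theorem windowMixDEC_of_mixLaw' (hL : GatedSliceMixLaw') : WindowMixDEC := by
  classical
  intro y z g S a j M ν hy0 hy1 hz0 hzν hg1 hyg ha hν0 hνM hν1 hSdef hta hjM hwin
  -- layers below the blob: criterion E
  by_cases hja : j < a
  · exact mixedShift_of_lt y z g S a j M ν hy0 hy1 hz0 hzν hg1 hyg ha hν0 hνM hν1 hja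
  have haj : a ≤ j := not_lt.1 hja
  have hM1 : 1 ≤ M := by omega
  have hν01 : ν 0 ≤ 1 := by
    have h01 := Finset.single_le_sum (f := ν) (fun h _ => hν0 h) (Finset.mem_range.2 (Nat.succ_pos M))
    rwa [hν1] at h01
  have hz1 : z < 1 := by
    by_contra hc
    have : (1 - z) * g ≤ 0 := by
      by_cases hg0 : 0 ≤ g
      · exact mul_nonpos_of_nonpos_of_nonneg (by linarith [not_lt.1 hc]) hg0
      · nlinarith [hzν, hν01, not_le.1 hg0]
    linarith
  have hg0 : 0 ≤ g := by
    by_contra hc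
    have hng : (1 - z) * g ≤ 0 := mul_nonpos_of_nonneg_of_nonpos (by linarith) (le_of_lt (not_le.1 hc))
    linarith
  have hyg' : y ≤ g := by nlinarith
  have hS0 : 0 < S := by
    have : (0 : ℝ) < y * M := mul_pos hy0 (by exact_mod_cast hM1)
    linarith
  -- law facts of the mixture; strong duality
  obtain ⟨p0, pM, p1, pmean⟩ := windowMix_laws ν a M g z ha hz0 hzν hg0 hg1 hν0 hνM hν1
  set t : ℝ := S + (a : ℝ) * g * (1 - z) with ht
  rw [decAtT_iff_prices y t j (M + a) _ hy0 hy1 pM p1]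
  intro α β hβ hαβ
  -- (1) the slice theorem's domination at the rule layer, target t − ag
  set T₀ : ℝ := S - (a : ℝ) * g * z with hT₀
  have htT₀ : T₀ + (a : ℝ) * g = t := by rw [hT₀, ht]; ring
  have hT₀S : T₀ ≤ S := by
    have : 0 ≤ (a : ℝ) * g * z := by positivity
    linarith
  have hαβ₀ : ∀ l h, l ≤ j → 2 * (l : ℝ) < T₀ + (a : ℝ) * g → h ≤ M + a →
      (j + 1 ≤ h ∨ T₀ + (a : ℝ) * g < (l : ℝ) + h) → α l ≤ usage y (T₀ + (a : ℝ) * g) j l h * β h := by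
    rw [htT₀]; exact hαβ
  obtain ⟨J, q₀, hJ1, hJ2, hJM, hq₀1, hq₀M, hq₀, hnotcheap, habs₀, hlows₀⟩ :=
    sliceSingleLayer_rule y g T₀ M a j α β hy0 hy1 hyg' hg1 ha hjM hβ hαβ₀
  rw [htT₀] at hnotcheap habs₀ hlows₀
  set Φ : ℕ → ℝ := slicePullback t g j a α β with hΦ
  obtain ⟨habsS, hlowsS⟩ := priceValid_mono_target y T₀ S J M Φ hy0 hy1 hT₀S habs₀ hlows₀
  have hdecJ : DECAtT y S J M ν := hwin J hJ1 hJ2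
  -- the zero is a t-low and an S-low; the zero move D
  set e : ℕ → ℝ := coefAt t j α β with he
  set D : ℝ := g * (e 0 - e a) with hD
  have ht0 : 0 < t := by
    have : 0 ≤ (a : ℝ) * g * (1 - z) := by
      have : 0 ≤ 1 - z := by linarith
      positivity
    linarith
  have he0 : e 0 = α 0 := by
    simp only [he, coefAt]
    rw [if_pos ⟨Nat.zero_le j, by push_cast; linarith⟩]
  -- the pullback with m = 0: Φ′ = Φ + zD + ζ([k=0] − z)
  have hpull : ∀ ζ k, windowMixPullback t g z S 0 ζ j a α β k = Φ k + z * D + ζ * ((if k = 0 then (1 : ℝ) else 0) - z) := by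
    intro ζ k
    simp only [windowMixPullback, hΦ, slicePullback, hD, he]
    ring
  by_cases hDle : D ≤ 0
  · -- (2) D ≤ 0: Φ + zD is still a price system at (S, J)
    refine windowMix_prices_of_layer y z g S t 0 0 a j M J ν α β hy0 hy1 hzν le_rfl hνM hν1 hSdef hjM hJM hdecJ ?_ ?_
    · intro h hhM hnl
      rw [hpull 0 h]
      have : z * D ≤ 0 := mul_nonpos_of_nonneg_of_nonpos hz0 hDle
      linarith [habsS h hhM hnl]
    · intro l h hlJ hlow hhM hcomp
      rw [hpull 0 l, hpull 0 h]
      have hzD : z * D ≤ 0 := mul_nonpos_of_nonneg_of_nonpos hz0 hDle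
      have hlh : l < h := by
        rcases hcomp with hc | hc
        · omega
        · have : (l : ℝ) < h := by linarith
          exact_mod_cast this
      have hu : 0 < usage y S J l h := usage_pos_of_compat y S J l h hy0 hy1 hlow hlh hcomp
      have h1 := hlowsS l h hlJ hlow hhM hcomp
      have h2 : usage y S J l h * (-Φ h) ≤ usage y S J l h * (-(Φ h + z * D + 0 * ((if h = 0 then (1 : ℝ) else 0) - z))) :=
        mul_le_mul_of_nonneg_left (by linarith) hu.le
      linarith
  have hDpos : 0 < D := not_le.1 hDle
  -- (3)/(4): the zero-mid pairs at layer J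
  by_cases hall : ∀ h, h ≤ J → S < (h : ℝ) → h ≤ M →
      (1 - pairGate y S 0 h) * e 0 + pairGate y S 0 h * Φ h ≤ 0
  · -- (3) the zero-repriced pullback (m = 0, ζ = D) is a price system at (S, J)
    have hpullD : ∀ k, windowMixPullback t g z S 0 D j a α β k = Φ k + D * (if k = 0 then (1 : ℝ) else 0) := by
      intro k; rw [hpull D k]; ring
    refine windowMix_prices_of_layer y z g S t 0 D a j M J ν α β hy0 hy1 hzν hDpos.le hνM hν1 hSdef hjM hJM hdecJ ?_ ?_
    · intro h hhM hnl
      have hh0 : h ≠ 0 := by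
        rintro rfl
        exact hnl ⟨Nat.zero_le J, by push_cast; linarith⟩
      rw [hpullD h, if_neg hh0, mul_zero, add_zero]
      exact habsS h hhM hnl
    · intro l h hlJ hlow hhM hcomp
      have hlh : l < h := by
        rcases hcomp with hc | hc
        · omega
        · have : (l : ℝ) < h := by linarith
          exact_mod_cast this
      have hh0 : h ≠ 0 := by omega
      rw [hpullD l, hpullD h, if_neg hh0, mul_zero, add_zero]
      by_cases hl0 : l = 0
      · subst hl0
        rw [if_pos rfl, mul_one]
        -- Φ 0 + D = e 0
        have hΦ0 : Φ 0 + D = e 0 := by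
          simp only [hΦ, slicePullback, hD, he, zero_add]
          ring
        rw [hΦ0]
        by_cases hJh : J + 1 ≤ h
        · -- a giant of ν at J: expensive by the rule, and e 0 ≤ (y/(1−y)) β q₀
          rw [usage_giant_eq y S J 0 h hJh]
          have hexp : β q₀ ≤ - Φ h := by
            by_cases hhj : h ≤ j
            · exact hnotcheap h hJh hhj hhM
            · have := slicePullback_trueGiant_expensive y g T₀ M a j α β hy0 hyg' hg1 h q₀ (by omega) hhM hq₀
              rwa [htT₀] at this
          have h0q : e 0 ≤ y / (1 - y) * β q₀ := by
            rw [he0]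
            have := hαβ 0 q₀ (Nat.zero_le j) (by push_cast; linarith) hq₀M (Or.inl hq₀1)
            rwa [usage_giant_eq y t j 0 q₀ hq₀1] at this
          have hux : 0 ≤ y / (1 - y) := div_nonneg hy0.le (by linarith)
          exact h0q.trans (mul_le_mul_of_nonneg_left hexp hux)
        · -- a zero-mid: the hypothesis `hall`
          have hhJ' : h ≤ J := by omega
          have hSh : S < (h : ℝ) := by
            rcases hcomp with hc | hc
            · omega
            · push_cast at hc; linarith
          have hγ1 : pairGate y S 0 h < 1 := pairGate_lt_one y S 0 h hy0 hy1 (by push_cast; linarith) (by push_cast; linarith)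
          have huse : usage y S J 0 h = pairGate y S 0 h / (1 - pairGate y S 0 h) := by
            simp only [usage, gateOf, if_neg hJh]
          rw [huse]
          have hh := hall h hhJ' hSh hhM
          rw [div_mul_eq_mul_div, le_div_iff₀ (by linarith)]
          nlinarith
      · rw [if_neg hl0, mul_zero, add_zero]
        exact hlowsS l h hlJ hlow hhM hcomp
  · -- (4) some zero-mid pair is violated: Z° and Lemma P
    push Not at hall
    obtain ⟨h, hhJ, hSh, hhM, hviol⟩ := hall
    set γ : ℝ := pairGate y S 0 h with hγ
    -- the de-gated law ν̂ and its two-point decomposition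
    set νh : ℕ → ℝ := fun q => (ν q - z * (if q = 0 then (1 : ℝ) else 0)) / (1 - z) with hνh
    have h1z : 0 < 1 - z := by linarith
    have hνh0 : ∀ q, 0 ≤ νh q := by
      intro q
      simp only [hνh]
      refine div_nonneg ?_ h1z.le
      by_cases hq : q = 0
      · subst hq; rw [if_pos rfl]; linarith
      · rw [if_neg hq]; linarith [hν0 q]
    have hνhM : ∀ q, M < q → νh q = 0 := by
      intro q hq
      simp only [hνh]
      rw [hνM q hq, if_neg (by omega)]; ring
    have hνh1 : ∑ q ∈ Finset.range (M + 1), νh q = 1 := by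
      simp only [hνh]
      rw [← Finset.sum_div, Finset.sum_sub_distrib, hν1, ← Finset.mul_sum, Finset.sum_ite_eq' (Finset.range (M + 1)) 0,
        if_pos (Finset.mem_range.2 (Nat.succ_pos M))]
      field_simp
    have hνhmean : ∑ q ∈ Finset.range (M + 1), (q : ℝ) * νh q = S / (1 - z) := by
      simp only [hνh]
      have e1 : ∀ q : ℕ, (q : ℝ) * ((ν q - z * (if q = 0 then (1 : ℝ) else 0)) / (1 - z))
          = ((q : ℝ) * ν q - z * (if q = 0 then ((q : ℝ)) else 0)) / (1 - z) := by
        intro q; split_ifs <;> ring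
      simp_rw [e1]
      rw [← Finset.sum_div, Finset.sum_sub_distrib, ← hSdef, ← Finset.mul_sum, Finset.sum_ite_eq' (Finset.range (M + 1)) 0,
        if_pos (Finset.mem_range.2 (Nat.succ_pos M))]
      push_cast; ring
    have hνrep : ∀ q, ν q = z * (if q = 0 then (1 : ℝ) else 0) + (1 - z) * νh q := by
      intro q; simp only [hνh]; field_simp; ring
    obtain ⟨lam, gg, lo, hi, hl0, hl1, hgg, hlohi, hhiM, hνdec, hgen⟩ :=
      exists_twoPoint_decomposition M M le_rfl νh hνh0 hνhM hνh1
    rw [hνhmean] at hgen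
    -- P as a mixture of the extreme transforms
    have hνrep' : ∀ q, ν q = z * (if q = 0 then (1 : ℝ) else 0) + (1 - z) * ∑ r, lam r * TP[lo r, hi r, gg r, q] := by
      intro q; rw [hνrep q, hνdec q]
    set Q : (Fin (M + 1) × Fin (M + 1)) → ℕ → ℝ :=
      fun r p => z * (if p = 0 then (1 : ℝ) else 0) + (1 - z) * slice (fun q => TP[lo r, hi r, gg r, q]) a g p with hQ
    have hPsum : ∀ p, (1 - g) * ν p + g * shiftBut ν a z p = ∑ r, lam r * Q r p := by
      intro p
      rw [windowMix_eq_sum_extreme ν lam (fun r q => TP[lo r, hi r, gg r, q]) a g z hl1 hνrep' p]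
    -- the zero-mid pair is heavy under TA: pairGate y S 0 h = S/h, so L_h is typer g29's weak-mid law
    have hh0 : (0 : ℝ) < h := by linarith
    have hγeq : γ = S / h := by
      rw [hγ]
      unfold pairGate
      have hρ : (S - 2 * ((0 : ℕ) : ℝ)) / ((h : ℝ) - ((0 : ℕ) : ℝ)) = S / h := by push_cast; ring
      rw [hρ]
      refine max_eq_left ?_
      have hyρ : y ≤ S / h := by
        rw [le_div_iff₀ hh0]
        have hhM' : (h : ℝ) ≤ M := by exact_mod_cast hhM
        exact (mul_le_mul_of_nonneg_left hhM' hy0.le).trans hta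
      have hyy : y * y ≤ y * (S / h) := mul_le_mul_of_nonneg_left hyρ hy0.le
      have e2 : y ^ 2 = y * y := sq y
      rw [e2]
      linarith [hyy]
    have heW : ∑ p ∈ Finset.range (M + a + 1), e p * weakMidLaw S g h a p = (1 - γ) * e 0 + γ * Φ h := by
      rw [sum_coef_weakMidLaw e S g h a (M + a) (by omega), hγeq]
      simp only [hΦ, slicePullback, he]
    -- W_h is NOT DEC at (t, j): it is violated by e
    have hWnot : ¬ DECAtT y t j (M + a) (weakMidLaw S g h a) := by
      intro hW
      have wd := dual_le_of_decAtT y t j (M + a) _ hy0 hy1 hW α β hβ hαβ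
      have wd_eq := dual_functional_eq t j (M + a) α β (weakMidLaw S g h a) hjM.le
      rw [heW] at wd_eq
      linarith [wd, wd_eq, hviol]
    -- each extreme transform is priced ≤ 0
    have hQr : ∀ r, 0 < lam r → ∑ p ∈ Finset.range (M + a + 1), e p * Q r p ≤ 0 := by
      intro r hr
      obtain ⟨_, _, hmean, _⟩ := hgen r hr
      have hmeanS : (1 - z) * ((lo r : ℝ) + ((hi r : ℝ) - lo r) * gg r) = S := by
        rw [hmean]; field_simp
      obtain ⟨θ, hθ0, hθ1, hdecmix⟩ := hL y z g S (gg r) a j M h (lo r) (hi r) hy0 hy1 hz0 hz1 hg1 hyg ha hjM hS0 hta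
        (hhJ.trans hJ2) hhM hSh (by rw [← ht]; exact hWnot) (hlohi r) (hhiM r) (hgg r).1 (hgg r).2 hmeanS
      rw [← ht] at hdecmix
      -- weak duality for the mixture
      have wd := dual_le_of_decAtT y t j (M + a) _ hy0 hy1 hdecmix α β hβ hαβ
      have wd_eq := dual_functional_eq t j (M + a) α β
        (fun p => θ * weakMidLaw S g h a p
          + (1 - θ) * (z * (if p = 0 then (1 : ℝ) else 0) + (1 - z) * slice (fun q => TP[lo r, hi r, gg r, q]) a g p)) hjM.le
      have hsplit : ∑ p ∈ Finset.range (M + a + 1), coefAt t j α β p *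
          (θ * weakMidLaw S g h a p
            + (1 - θ) * (z * (if p = 0 then (1 : ℝ) else 0) + (1 - z) * slice (fun q => TP[lo r, hi r, gg r, q]) a g p))
          = θ * ∑ p ∈ Finset.range (M + a + 1), e p * weakMidLaw S g h a p + (1 - θ) * ∑ p ∈ Finset.range (M + a + 1), e p * Q r p := by
        rw [Finset.mul_sum, Finset.mul_sum, ← Finset.sum_add_distrib]
        refine Finset.sum_congr rfl fun p _ => ?_
        simp only [hQ, he]
        ring
      rw [hsplit, heW] at wd_eq
      have hmix : θ * ((1 - γ) * e 0 + γ * Φ h) + (1 - θ) * ∑ p ∈ Finset.range (M + a + 1), e p * Q r p ≤ 0 := by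
        linarith [wd, wd_eq]
      have h1 : 0 ≤ θ * ((1 - γ) * e 0 + γ * Φ h) := mul_nonneg hθ0 hviol.le
      have h2 : (1 - θ) * ∑ p ∈ Finset.range (M + a + 1), e p * Q r p ≤ 0 := by linarith
      by_contra hc
      have : 0 < (1 - θ) * ∑ p ∈ Finset.range (M + a + 1), e p * Q r p := mul_pos (by linarith) (not_le.1 hc)
      linarith
    -- assemble
    have goal_eq := dual_functional_eq t j (M + a) α β (fun p => (1 - g) * ν p + g * shiftBut ν a z p) hjM.le
    have hsum : ∑ p ∈ Finset.range (M + a + 1), coefAt t j α β p * ((1 - g) * ν p + g * shiftBut ν a z p)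
        = ∑ r, lam r * ∑ p ∈ Finset.range (M + a + 1), e p * Q r p := by
      simp_rw [hPsum, Finset.mul_sum]
      rw [Finset.sum_comm]
      refine Finset.sum_congr rfl fun r _ => ?_
      refine Finset.sum_congr rfl fun p _ => ?_
      simp only [he]; ring
    have hle : ∑ r, lam r * ∑ p ∈ Finset.range (M + a + 1), e p * Q r p ≤ 0 := by
      refine Finset.sum_nonpos fun r _ => ?_
      rcases (hl0 r).eq_or_lt with hz' | hpos
      · rw [← hz', zero_mul]
      · exact mul_nonpos_of_nonneg_of_nonpos (hl0 r) (hQr r hpos)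
    rw [hsum] at goal_eq
    linarith [goal_eq, hle]

/-! ### (4) PM in full from `GatedSliceMixLaw'`, in the lead's binder -/

/-- **`GatedSliceMixLaw' ⟹ SDEC-UP-TO-`Q` IS CLOSED UNDER SLICING BY ANY HEAVY BLOB`** (via `windowMixDEC_of_mixLaw'` and
`sdecUpTo_slice_of_windowMix`; cf. typer g29's `sdecUpTo_slice_blob_of_mixLaw'`). [this work] -/
theorem sdecUpTo_slice_of_mixLaw' (hL : GatedSliceMixLaw') (x Q g : ℝ) (a M : ℕ) (μ : ℕ → ℝ) (hx0 : 0 < x)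
    (hQ1 : Q ≤ 1) (hQx : Q * x < 1) (hxg : x ≤ g) (hg1 : g ≤ 1) (ha : 1 ≤ a)
    (hμ0 : ∀ h, 0 ≤ μ h) (hμM : ∀ h, M < h → μ h = 0) (hμ1 : ∑ h ∈ Finset.range (M + 1), μ h = 1)
    (hta : x * (M : ℝ) ≤ ∑ h ∈ Finset.range (M + 1), (h : ℝ) * μ h)
    (hS : SDECUpTo x Q M μ) :
    SDECUpTo x Q (M + a) (slice μ a g) :=
  sdecUpTo_slice_of_windowMix (windowMixDEC_of_mixLaw' hL) x Q g a M μ hx0 hQ1 hQx hxg hg1 ha hμ0 hμM hμ1 hta hS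

/-- **`GatedSliceMixLaw' ⟹ SDEC IS CLOSED UNDER SLICING BY ANY HEAVY BLOB`** (`Q = 1`). [this work] -/
theorem sdec_slice_of_mixLaw' (hL : GatedSliceMixLaw') (x g : ℝ) (a M : ℕ) (μ : ℕ → ℝ) (hx0 : 0 < x) (hx1 : x < 1)
    (hxg : x ≤ g) (hg1 : g ≤ 1) (ha : 1 ≤ a) (hμ0 : ∀ h, 0 ≤ μ h) (hμM : ∀ h, M < h → μ h = 0)
    (hμ1 : ∑ h ∈ Finset.range (M + 1), μ h = 1)
    (hta : x * (M : ℝ) ≤ ∑ h ∈ Finset.range (M + 1), (h : ℝ) * μ h) (hS : SDEC x M μ) :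
    SDEC x (M + a) (slice μ a g) :=
  sdec_slice_of_windowMix (windowMixDEC_of_mixLaw' hL) x g a M μ hx0 hx1 hxg hg1 ha hμ0 hμM hμ1 hta hS

end LawDec

end Quant

end Summit.CriticalPhenomena.PercolationContinuityZ3.Theorems
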